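import Summits.ResolutionOfSingularities.ResolutionOfSingularities.Theorems.EquisingularLiftEquisingularLiftNatFatTouchNotFinishing
import HarnessLib

/-!
# [OURS · L1 W4.5(b) · EL♮] T-FAT-NOT-PROGRESS: at an ANISOTROPIC point a FAT centre has PRINCIPAL trace, so it is never a progress touch —
# the ring core of T-FAT-NOT-FINISHING (p522183) without the «finishing» hypothesis, plus transport of anisotropy along ring isomorphisms
# (crux `EquisingularLiftNat` = stmt-ResolutionOfSingularities-20038; K-∀n / K5-BMY necessity lane, kill test #50)

HONEST FRAMING. OURS (cell res-hironaka, crux chain w45b, slot W4.5(b)); NOT a statement of any manuscript; replaces the role of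
NOTHING in the manuscript; AI-written, AI review is weaker than expert review. Helper `--supports stmt-ResolutionOfSingularities-20038
--as helper`. Companion of T-FIRST-PROGRESS (`…NatFirstProgressTouch`: the first progress touch over `x` happens at a point `w₁` with
`𝒪_{V(closure Y₁), w₁} ≃+* 𝒪_{V(Y), w₀}`): the hypotheses below that are intrinsic to that `2`-dimensional local ring (dimension,
non-regularity, anisotropy) are therefore checked on the SPECIMEN's `𝒪_{H, η_S}`.

* `aniso_of_ringEquiv` — anisotropy clause (a) («`(s)` prime for every `s ∈ 𝔪 ∖ 𝔪²`») is invariant under ring isomorphisms;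
* `isPrincipal_trace_of_fat_of_aniso` — at `x₁ = ι w` with `𝒪_{X₁,x₁}` regular of dimension `4`, `𝒪_{Z₁,w}` of dimension `2`, NOT
  regular, anisotropic, a centre `C` with `𝒪_{X₁,x₁} ⧸ C_{x₁}` regular of dimension `2` (FAT) and stalk-E1 `P ≤ √(C_{x₁} + (ϖ))`, `ϖ ∈ P`:
  the trace `(C·𝒪_{Z₁})_w` IS PRINCIPAL (`…AnisoInertia.exists_map_span_pair_eq_span_singleton` p515200 + the dictionary of p522183);
* `not_fat_of_progress_touch_of_aniso` — contrapositive: a PROGRESS touch (non-principal trace) at such a point is not fat.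

References: tree `…NatFatTouchNotFinishing` (p522183), `…NatK5BMYFatTouchInert` (p515200), `…NatTraceIso` (p518228).
-/

set_option linter.dupNamespace false -- mandated namespace `Summit.<Summit>.<Problem>` of this single-conjunct summit

universe u

open CategoryTheory AlgebraicGeometry TopologicalSpace Topology IsLocalRing
open Literature.AlgebraicGeometry.Resolution
open AlgebraicGeometry.Scheme.IdealSheafData

namespace Summit.ResolutionOfSingularities.ResolutionOfSingularities.Cruxes.EquisingularLiftNat.Sections

/-! ## Anisotropy is invariant under ring isomorphisms -/

/-- The anisotropy clause (a) — «`(s)` is a prime ideal for every `s ∈ 𝔪 ∖ 𝔪²`» — transports along a ring isomorphism of local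
rings. [folklore] -/
theorem aniso_of_ringEquiv {R S : Type*} [CommRing R] [CommRing S] [IsLocalRing R] [IsLocalRing S] (e : R ≃+* S)
    (hR : ∀ r : R, r ∈ maximalIdeal R → r ∉ (maximalIdeal R) ^ 2 → (Ideal.span {r}).IsPrime) :
    ∀ s : S, s ∈ maximalIdeal S → s ∉ (maximalIdeal S) ^ 2 → (Ideal.span {s}).IsPrime := by
  intro s hs hs2
  have hm : (maximalIdeal R).map e.toRingHom = maximalIdeal S :=
    IsLocalRing.map_maximalIdeal_of_surjective e.toRingHom e.surjective
  have hr : e.symm s ∈ maximalIdeal R := by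
    have : e.symm s ∈ (maximalIdeal S).map e.symm.toRingHom := Ideal.mem_map_of_mem _ hs
    rwa [IsLocalRing.map_maximalIdeal_of_surjective e.symm.toRingHom e.symm.surjective] at this
  have hr2 : e.symm s ∉ (maximalIdeal R) ^ 2 := by
    intro h
    apply hs2
    have : e (e.symm s) ∈ ((maximalIdeal R) ^ 2).map e.toRingHom := Ideal.mem_map_of_mem _ h
    rwa [Ideal.map_pow, hm, e.apply_symm_apply] at this
  have hprime := hR (e.symm s) hr hr2
  have hmap : (Ideal.span {e.symm s}).map e.toRingHom = Ideal.span {s} := by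
    rw [Ideal.map_span, Set.image_singleton]
    change Ideal.span {e (e.symm s)} = _
    rw [e.apply_symm_apply]
  rw [← hmap]
  exact Ideal.map_isPrime_of_equiv e

/-! ## A fat centre at an anisotropic point has principal trace -/

/-- **At an anisotropic point a FAT centre has PRINCIPAL trace.** `X₁` locally Noetherian, `Y₁ ⊆ X₁` with closure irreducible,
`w ∈ Z₁ := V(closure Y₁)`, `x₁ := ι w`, `R := 𝒪_{X₁,x₁}` regular of dimension `4`, `𝒪_{Z₁,w}` of dimension `2`, NOT regular, with
anisotropic tangent cone (clause (a)); `C` an ideal sheaf with `R ⧸ C_{x₁}` regular of dimension `2` (FAT), `ϖ ∈ P := ker (R → 𝒪_{Z₁,w})`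
and stalk-E1 `P ≤ √(C_{x₁} + (ϖ))`. Then `(C·𝒪_{Z₁})_w` is principal (`…AnisoInertia`, p515200). [folklore] -/
theorem isPrincipal_trace_of_fat_of_aniso {X₁ : AlgebraicGeometry.Scheme.{0}} [AlgebraicGeometry.IsLocallyNoetherian X₁]
    (Y₁ : Set X₁) (hirr : IsIrreducible (closure Y₁)) (C : X₁.IdealSheafData) (w : ↥(AlgebraicGeometry.Scheme.IdealSheafData.vanishingIdeal (⟨closure Y₁, isClosed_closure⟩ : TopologicalSpace.Closeds X₁)).subscheme)
    (hw : ¬ IsRegularLocalRing ((AlgebraicGeometry.Scheme.IdealSheafData.vanishingIdeal (⟨closure Y₁, isClosed_closure⟩ : TopologicalSpace.Closeds X₁)).subscheme.presheaf.stalk w))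
    (hR : IsRegularLocalRing (X₁.presheaf.stalk ((AlgebraicGeometry.Scheme.IdealSheafData.vanishingIdeal (⟨closure Y₁, isClosed_closure⟩ : TopologicalSpace.Closeds X₁)).subschemeι w)))
    (hR4 : ringKrullDim (X₁.presheaf.stalk ((AlgebraicGeometry.Scheme.IdealSheafData.vanishingIdeal (⟨closure Y₁, isClosed_closure⟩ : TopologicalSpace.Closeds X₁)).subschemeι w)) = 4)
    (hZ2 : ringKrullDim ((AlgebraicGeometry.Scheme.IdealSheafData.vanishingIdeal (⟨closure Y₁, isClosed_closure⟩ : TopologicalSpace.Closeds X₁)).subscheme.presheaf.stalk w) = 2)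
    (hAniso : ∀ s : (AlgebraicGeometry.Scheme.IdealSheafData.vanishingIdeal (⟨closure Y₁, isClosed_closure⟩ : TopologicalSpace.Closeds X₁)).subscheme.presheaf.stalk w,
      s ∈ IsLocalRing.maximalIdeal _ → s ∉ (IsLocalRing.maximalIdeal _) ^ 2 → (Ideal.span {s}).IsPrime)
    (hCreg : IsRegularLocalRing (X₁.presheaf.stalk ((AlgebraicGeometry.Scheme.IdealSheafData.vanishingIdeal (⟨closure Y₁, isClosed_closure⟩ : TopologicalSpace.Closeds X₁)).subschemeι w) ⧸ stalkIdeal C ((AlgebraicGeometry.Scheme.IdealSheafData.vanishingIdeal (⟨closure Y₁, isClosed_closure⟩ : TopologicalSpace.Closeds X₁)).subschemeι w)))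
    (hC2 : ringKrullDim (X₁.presheaf.stalk ((AlgebraicGeometry.Scheme.IdealSheafData.vanishingIdeal (⟨closure Y₁, isClosed_closure⟩ : TopologicalSpace.Closeds X₁)).subschemeι w) ⧸ stalkIdeal C ((AlgebraicGeometry.Scheme.IdealSheafData.vanishingIdeal (⟨closure Y₁, isClosed_closure⟩ : TopologicalSpace.Closeds X₁)).subschemeι w)) = 2)
    (ϖ : X₁.presheaf.stalk ((AlgebraicGeometry.Scheme.IdealSheafData.vanishingIdeal (⟨closure Y₁, isClosed_closure⟩ : TopologicalSpace.Closeds X₁)).subschemeι w))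
    (hϖ : ϖ ∈ RingHom.ker ((AlgebraicGeometry.Scheme.IdealSheafData.vanishingIdeal (⟨closure Y₁, isClosed_closure⟩ : TopologicalSpace.Closeds X₁)).subschemeι.stalkMap w).hom)
    (hE1 : RingHom.ker ((AlgebraicGeometry.Scheme.IdealSheafData.vanishingIdeal (⟨closure Y₁, isClosed_closure⟩ : TopologicalSpace.Closeds X₁)).subschemeι.stalkMap w).hom ≤ (stalkIdeal C ((AlgebraicGeometry.Scheme.IdealSheafData.vanishingIdeal (⟨closure Y₁, isClosed_closure⟩ : TopologicalSpace.Closeds X₁)).subschemeι w) ⊔ Ideal.span {ϖ}).radical) :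
    (stalkIdeal (C.comap (AlgebraicGeometry.Scheme.IdealSheafData.vanishingIdeal (⟨closure Y₁, isClosed_closure⟩ : TopologicalSpace.Closeds X₁)).subschemeι) w).IsPrincipal := by
  haveI : IsIntegral (AlgebraicGeometry.Scheme.IdealSheafData.vanishingIdeal (⟨closure Y₁, isClosed_closure⟩ : TopologicalSpace.Closeds X₁)).subscheme :=
    ComponentGluing.isIntegral_subscheme_vanishingIdeal ⟨closure Y₁, isClosed_closure⟩ hirr
  have hsurj : Function.Surjective ((AlgebraicGeometry.Scheme.IdealSheafData.vanishingIdeal (⟨closure Y₁, isClosed_closure⟩ : TopologicalSpace.Closeds X₁)).subschemeι.stalkMap w).hom := (AlgebraicGeometry.Scheme.IdealSheafData.vanishingIdeal (⟨closure Y₁, isClosed_closure⟩ : TopologicalSpace.Closeds X₁)).subschemeι.stalkMap_surjective w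
  haveI hPk : (RingHom.ker ((AlgebraicGeometry.Scheme.IdealSheafData.vanishingIdeal (⟨closure Y₁, isClosed_closure⟩ : TopologicalSpace.Closeds X₁)).subschemeι.stalkMap w).hom).IsPrime := RingHom.ker_isPrime _
  haveI : IsRegularLocalRing (X₁.presheaf.stalk ((AlgebraicGeometry.Scheme.IdealSheafData.vanishingIdeal (⟨closure Y₁, isClosed_closure⟩ : TopologicalSpace.Closeds X₁)).subschemeι w)) := hR
  have hP2 : ringKrullDim (X₁.presheaf.stalk ((AlgebraicGeometry.Scheme.IdealSheafData.vanishingIdeal (⟨closure Y₁, isClosed_closure⟩ : TopologicalSpace.Closeds X₁)).subschemeι w) ⧸ RingHom.ker ((AlgebraicGeometry.Scheme.IdealSheafData.vanishingIdeal (⟨closure Y₁, isClosed_closure⟩ : TopologicalSpace.Closeds X₁)).subschemeι.stalkMap w).hom) = 2 :=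
    (ringKrullDim_quotient_ker_stalkMap (AlgebraicGeometry.Scheme.IdealSheafData.vanishingIdeal (⟨closure Y₁, isClosed_closure⟩ : TopologicalSpace.Closeds X₁)).subschemeι w).trans hZ2
  have hPA : ¬ IsRegularLocalRing (X₁.presheaf.stalk ((AlgebraicGeometry.Scheme.IdealSheafData.vanishingIdeal (⟨closure Y₁, isClosed_closure⟩ : TopologicalSpace.Closeds X₁)).subschemeι w) ⧸ RingHom.ker ((AlgebraicGeometry.Scheme.IdealSheafData.vanishingIdeal (⟨closure Y₁, isClosed_closure⟩ : TopologicalSpace.Closeds X₁)).subschemeι.stalkMap w).hom) :=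
    fun h => hw ((isRegularLocalRing_quotient_ker_stalkMap_iff (AlgebraicGeometry.Scheme.IdealSheafData.vanishingIdeal (⟨closure Y₁, isClosed_closure⟩ : TopologicalSpace.Closeds X₁)).subschemeι w).mp h)
  have hAnisoR : ∀ r : X₁.presheaf.stalk ((AlgebraicGeometry.Scheme.IdealSheafData.vanishingIdeal (⟨closure Y₁, isClosed_closure⟩ : TopologicalSpace.Closeds X₁)).subschemeι w), r ∈ maximalIdeal _ →
      r ∉ (maximalIdeal _) ^ 2 ⊔ RingHom.ker ((AlgebraicGeometry.Scheme.IdealSheafData.vanishingIdeal (⟨closure Y₁, isClosed_closure⟩ : TopologicalSpace.Closeds X₁)).subschemeι.stalkMap w).hom →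
      (RingHom.ker ((AlgebraicGeometry.Scheme.IdealSheafData.vanishingIdeal (⟨closure Y₁, isClosed_closure⟩ : TopologicalSpace.Closeds X₁)).subschemeι.stalkMap w).hom ⊔ Ideal.span {r}).IsPrime := by
    intro r hr hr2
    rw [isPrime_ker_sup_span_singleton_iff _ hsurj r]
    refine hAniso _ ?_ ?_
    · have hm := IsLocalRing.map_maximalIdeal_of_surjective ((AlgebraicGeometry.Scheme.IdealSheafData.vanishingIdeal (⟨closure Y₁, isClosed_closure⟩ : TopologicalSpace.Closeds X₁)).subschemeι.stalkMap w).hom hsurj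
      rw [← hm]; exact Ideal.mem_map_of_mem _ hr
    · rwa [← mem_sq_sup_ker_iff _ hsurj r]
  haveI : IsRegularLocalRing (X₁.presheaf.stalk ((AlgebraicGeometry.Scheme.IdealSheafData.vanishingIdeal (⟨closure Y₁, isClosed_closure⟩ : TopologicalSpace.Closeds X₁)).subschemeι w) ⧸ stalkIdeal C ((AlgebraicGeometry.Scheme.IdealSheafData.vanishingIdeal (⟨closure Y₁, isClosed_closure⟩ : TopologicalSpace.Closeds X₁)).subschemeι w)) := hCreg
  have hJne : stalkIdeal C ((AlgebraicGeometry.Scheme.IdealSheafData.vanishingIdeal (⟨closure Y₁, isClosed_closure⟩ : TopologicalSpace.Closeds X₁)).subschemeι w) ≠ ⊤ := Ideal.Quotient.nontrivial_iff.mp inferInstance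
  have hJm : stalkIdeal C ((AlgebraicGeometry.Scheme.IdealSheafData.vanishingIdeal (⟨closure Y₁, isClosed_closure⟩ : TopologicalSpace.Closeds X₁)).subschemeι w) ≤ maximalIdeal _ := IsLocalRing.le_maximalIdeal hJne
  obtain ⟨a, b, ha, hb, hJab⟩ := exists_pair_span_eq_of_isRegularLocalRing_quotient hJm (by rw [hC2, hR4]; rfl)
  have hB : IsRegularLocalRing (X₁.presheaf.stalk ((AlgebraicGeometry.Scheme.IdealSheafData.vanishingIdeal (⟨closure Y₁, isClosed_closure⟩ : TopologicalSpace.Closeds X₁)).subschemeι w) ⧸ Ideal.span {a, b}) := by rw [← hJab]; exact hCreg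
  have hdimB : ringKrullDim (X₁.presheaf.stalk ((AlgebraicGeometry.Scheme.IdealSheafData.vanishingIdeal (⟨closure Y₁, isClosed_closure⟩ : TopologicalSpace.Closeds X₁)).subschemeι w) ⧸ Ideal.span {a, b}) = 2 := by rw [← hJab]; exact hC2
  have hE1' : RingHom.ker ((AlgebraicGeometry.Scheme.IdealSheafData.vanishingIdeal (⟨closure Y₁, isClosed_closure⟩ : TopologicalSpace.Closeds X₁)).subschemeι.stalkMap w).hom ≤ (Ideal.span {a, b, ϖ}).radical := by
    have e : Ideal.span {a, b, ϖ} = stalkIdeal C ((AlgebraicGeometry.Scheme.IdealSheafData.vanishingIdeal (⟨closure Y₁, isClosed_closure⟩ : TopologicalSpace.Closeds X₁)).subschemeι w) ⊔ Ideal.span {ϖ} := by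
      rw [hJab]
      simp only [Ideal.span_insert, sup_assoc]
    rw [e]; exact hE1
  obtain ⟨c, hc⟩ := AnisoInertia.exists_map_span_pair_eq_span_singleton hR4 hP2 hPA hAnisoR hϖ ha hb hB hdimB hE1'
  refine isPrincipal_stalkIdeal_comap_of_map_mk (AlgebraicGeometry.Scheme.IdealSheafData.vanishingIdeal (⟨closure Y₁, isClosed_closure⟩ : TopologicalSpace.Closeds X₁)).subschemeι C w ⟨c, ?_⟩
  change Ideal.map _ (stalkIdeal C ((AlgebraicGeometry.Scheme.IdealSheafData.vanishingIdeal (⟨closure Y₁, isClosed_closure⟩ : TopologicalSpace.Closeds X₁)).subschemeι w)) = _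
  rw [hJab]
  exact hc

/-- **A PROGRESS touch at an anisotropic point is NOT FAT** (contrapositive): with the pointwise data of
`isPrincipal_trace_of_fat_of_aniso` except the fat dimension, a NON-principal trace forces `dim (𝒪_{X₁,x₁} ⧸ C_{x₁}) ≠ 2`. [folklore] -/
theorem not_fat_of_progress_touch_of_aniso {X₁ : AlgebraicGeometry.Scheme.{0}} [AlgebraicGeometry.IsLocallyNoetherian X₁]
    (Y₁ : Set X₁) (hirr : IsIrreducible (closure Y₁)) (C : X₁.IdealSheafData) (w : ↥(AlgebraicGeometry.Scheme.IdealSheafData.vanishingIdeal (⟨closure Y₁, isClosed_closure⟩ : TopologicalSpace.Closeds X₁)).subscheme)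
    (hprog : ¬ (stalkIdeal (C.comap (AlgebraicGeometry.Scheme.IdealSheafData.vanishingIdeal (⟨closure Y₁, isClosed_closure⟩ : TopologicalSpace.Closeds X₁)).subschemeι) w).IsPrincipal)
    (hw : ¬ IsRegularLocalRing ((AlgebraicGeometry.Scheme.IdealSheafData.vanishingIdeal (⟨closure Y₁, isClosed_closure⟩ : TopologicalSpace.Closeds X₁)).subscheme.presheaf.stalk w))
    (hR : IsRegularLocalRing (X₁.presheaf.stalk ((AlgebraicGeometry.Scheme.IdealSheafData.vanishingIdeal (⟨closure Y₁, isClosed_closure⟩ : TopologicalSpace.Closeds X₁)).subschemeι w)))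
    (hR4 : ringKrullDim (X₁.presheaf.stalk ((AlgebraicGeometry.Scheme.IdealSheafData.vanishingIdeal (⟨closure Y₁, isClosed_closure⟩ : TopologicalSpace.Closeds X₁)).subschemeι w)) = 4)
    (hZ2 : ringKrullDim ((AlgebraicGeometry.Scheme.IdealSheafData.vanishingIdeal (⟨closure Y₁, isClosed_closure⟩ : TopologicalSpace.Closeds X₁)).subscheme.presheaf.stalk w) = 2)
    (hAniso : ∀ s : (AlgebraicGeometry.Scheme.IdealSheafData.vanishingIdeal (⟨closure Y₁, isClosed_closure⟩ : TopologicalSpace.Closeds X₁)).subscheme.presheaf.stalk w,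
      s ∈ IsLocalRing.maximalIdeal _ → s ∉ (IsLocalRing.maximalIdeal _) ^ 2 → (Ideal.span {s}).IsPrime)
    (hCreg : IsRegularLocalRing (X₁.presheaf.stalk ((AlgebraicGeometry.Scheme.IdealSheafData.vanishingIdeal (⟨closure Y₁, isClosed_closure⟩ : TopologicalSpace.Closeds X₁)).subschemeι w) ⧸ stalkIdeal C ((AlgebraicGeometry.Scheme.IdealSheafData.vanishingIdeal (⟨closure Y₁, isClosed_closure⟩ : TopologicalSpace.Closeds X₁)).subschemeι w)))
    (ϖ : X₁.presheaf.stalk ((AlgebraicGeometry.Scheme.IdealSheafData.vanishingIdeal (⟨closure Y₁, isClosed_closure⟩ : TopologicalSpace.Closeds X₁)).subschemeι w))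
    (hϖ : ϖ ∈ RingHom.ker ((AlgebraicGeometry.Scheme.IdealSheafData.vanishingIdeal (⟨closure Y₁, isClosed_closure⟩ : TopologicalSpace.Closeds X₁)).subschemeι.stalkMap w).hom)
    (hE1 : RingHom.ker ((AlgebraicGeometry.Scheme.IdealSheafData.vanishingIdeal (⟨closure Y₁, isClosed_closure⟩ : TopologicalSpace.Closeds X₁)).subschemeι.stalkMap w).hom ≤ (stalkIdeal C ((AlgebraicGeometry.Scheme.IdealSheafData.vanishingIdeal (⟨closure Y₁, isClosed_closure⟩ : TopologicalSpace.Closeds X₁)).subschemeι w) ⊔ Ideal.span {ϖ}).radical) :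
    ringKrullDim (X₁.presheaf.stalk ((AlgebraicGeometry.Scheme.IdealSheafData.vanishingIdeal (⟨closure Y₁, isClosed_closure⟩ : TopologicalSpace.Closeds X₁)).subschemeι w) ⧸ stalkIdeal C ((AlgebraicGeometry.Scheme.IdealSheafData.vanishingIdeal (⟨closure Y₁, isClosed_closure⟩ : TopologicalSpace.Closeds X₁)).subschemeι w)) ≠ 2 :=
  fun hC2 => hprog (isPrincipal_trace_of_fat_of_aniso Y₁ hirr C w hw hR hR4 hZ2 hAniso hCreg hC2 ϖ hϖ hE1)

end Summit.ResolutionOfSingularities.ResolutionOfSingularities.Cruxes.EquisingularLiftNat.Sections
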